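import Summits.BirchSwinnertonDyer.BirchSwinnertonDyer.Theorems.GenusKolyvaginAtTwoPowDvdShaCardAtTwoRTRelaxedCountKummer
import Summits.BirchSwinnertonDyer.BirchSwinnertonDyer.Theorems.GenusKolyvaginAtTwoPowDvdShaCardAtTwoRTLevelRange
import Summits.BirchSwinnertonDyer.BirchSwinnertonDyer.Theorems.GenusKolyvaginAtTwoEquivariantKolyvaginExactAtTwoLocalDualityOrder
import Summits.BirchSwinnertonDyer.BirchSwinnertonDyer.Theorems.GenusKolyvaginAtTwoVisiblePairAtTwoInjective
import Literature.NumberTheory.EllipticCurves.WeilPairingProofs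
import Summits.BirchSwinnertonDyer.BirchSwinnertonDyer.Theorems.GenusKolyvaginAtTwoEquivariantKolyvaginExactAtTwoTwinGrossPrimes
import Literature.NumberTheory.EllipticCurves.ExceptionalPrimesDensityModels
import HarnessLib

/-!
# Route `GenusKolyvaginAtTwo`, crux L_T `PowDvdShaCardAtTwoRT` (stmt-BirchSwinnertonDyer-23242), LINE 18 stub L, bottom rung:
# AN ORDER-4 AUXILIARY CLASS, UNCONDITIONALLY — `∃ y ∈ H¹_{𝓛, ⊤ on T}(ℚ, E[4])` with `2y ≠ 0`, for `T` a non-empty set of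
# Kolyvagin primes of index `≥ 2` on `Δ < 0`

LEAD seat `bsd-line-gk2-p1` g16 (cell `bsd-f1-sign2`), `--supports 23242 --as helper`.  THEOREMS ONLY; no `sorry`; standard axioms.
BSD is NOT proved by any of this; neither is the crux nor stub L.

WHY (memo `Cruxes/PowDvdShaCardAtTwoRT/Lines/plus-descent-lead-g16.md` §2).  The bottom-rung engine for index-≥2 witnesses pairs
`X = 2·desc c₂(nℓ′)` with an auxiliary `y ∈ H¹(ℚ, E[4])` of ORDER 4 that is Kummer off the primes of `n` and free at the non-deep own
primes.  `…RTRelaxedCountKummer.exists_mem_solutions_nsmul_ne_zero_canonical` reduces its existence to a numerical inequality plus four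
displayed properties of the level map; `…RTLevelRange` discharges the level-map properties for `ι = H¹(E[2] ↪ E[4])`; this file
discharges the numbers at Kolyvagin primes and assembles the simplest instance (every place of `T` free — the case of a witness
with no deep prime, and the model for the general one):
* `natCard_galoisCohomology_one_toLocal_two_pow_eq` — **`#H¹(ℚ_ℓ, E[2^M]) = 4^M`** at a Gross–Kolyvagin prime `ℓ` of index `≥ M` on
  `Δ < 0` (Tate's local count off `2`, `LocalDualityOrder.natCard_galoisCohomology_one_torsion_eq_sq_of_not_mem`, with
  `#E(ℚ_ℓ)[2^M] = 2^M`, `natCard_ker_zsmul_adicCompletion_two_pow_eq` — McCallum Lemma 5.3's cyclic local groups over `ℚ_ℓ`);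
* **`exists_mem_kummerOutside_four_two_nsmul_ne_zero`** — `E/ℚ` with `Δ < 0` and `E(ℚ)[2] = 0`, `T ≠ ∅` a finite set of places at
  Gross–Kolyvagin primes `ℓ ≠ 2` of good reduction and `kolyvaginIndex ≥ 2`: there is `y ∈ H¹_{𝓛,⊤ on T}(ℚ, E[4])` with `2•y ≠ 0`
  (numbers: `∏_T 4 · ∏_T 16 = 64^{#T} < 256^{#T} = (∏_T 16)²`).
HONEST FRAMING: unconditional (inputs: Poitou–Tate for the canonical family, Tate's local Euler characteristic, the Weil pairing,
divisibility of `E(ℚ̄)`, all tree theorems); the general engine instance (deep own primes constrained to McCallum's eigen-line, a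
subgroup of order 8) needs in addition the order of that condition; closes nothing.  BSD is NOT proved by any of this.

References: [McCallumLMS1991] §2 Prop. 2.1, §5 Lemma 5.3 and proof of Prop. 5.2; [MilneADT2006] Ch. I Thm. 2.8, Cor. 2.3, Thm. 4.10;
[GrossLMS1991] §3 (3.2)–(3.3); [GreenbergLNM1716] §2 p. 63.
-/

set_option autoImplicit false
-- the Theorems namespace of this sub repeats the summit name by design (D-0017 nested layout)
set_option linter.dupNamespace false

noncomputable section

open scoped Classical

open CategoryTheory Field NumberField IsDedekindDomain Function
open _root_.WeierstrassCurve
open Literature.NumberTheory.EllipticCurves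
open Literature.NumberTheory.GaloisRepresentations
open Literature.NumberTheory.GaloisCohomology
open Summit.BirchSwinnertonDyer.Rank1Residual.X11b.KummerPT
open Summit.BirchSwinnertonDyer.Rank1Residual.X11b.FiniteDuality
open Summit.BirchSwinnertonDyer.Rank1Residual.X11b.LocBridge Summit.BirchSwinnertonDyer.Rank1Residual.X11b.Levels
open scoped ContRepresentation

namespace Summit.BirchSwinnertonDyer.BirchSwinnertonDyer.Theorems.GenusExact.RelaxedCount

open Summit.BirchSwinnertonDyer.BirchSwinnertonDyer.Theorems.GenusExact.ReductionCyclic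
open Summit.BirchSwinnertonDyer.BirchSwinnertonDyer.Theorems.GenusExact.LocalDualityOrder

variable (W : WeierstrassCurve ℚ) [W.IsElliptic] [W.IsGloballyMinimal]

/-! ## §1 The local count at a Gross–Kolyvagin prime -/

/-- **`#H¹(ℚ_ℓ, E[2^M]) = 4^M` at a Gross–Kolyvagin prime of index `≥ M`** (`Δ < 0`, `ℓ ≠ 2` of good reduction, `Frob_ℓ = Frob_∞`,
`1 ≤ M ≤ kolyvaginIndex`): Tate's local Euler characteristic off `2` gives `#H¹(ℚ_ℓ, E[2^M]) = #E(ℚ_ℓ)[2^M]²`, and `E(ℚ_ℓ)[2^M]` is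
cyclic of order `2^M` (McCallum Lemma 5.3 over `ℚ_ℓ`). [cite: McCallumLMS1991, §5 Lemma 5.3] [cite: MilneADT2006, Ch. I, Thm. 2.8] -/
theorem natCard_galoisCohomology_one_toLocal_two_pow_eq (hΔ : W.Δ < 0)
    {K : Type} [Field K] [NumberField K] {ℓ : ℕ} [Fact ℓ.Prime] (hℓ2 : ℓ ≠ 2)
    (hgoodℓ : W.HasGoodReductionAtPrime ℓ) (hℓ : FrobEqFrobInfty W K 2 ℓ)
    {v : HeightOneSpectrum (𝓞 ℚ)} (hv : (ℓ : 𝓞 ℚ) ∈ v.asIdeal) {M : ℕ} (hM0 : M ≠ 0)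
    (hM : M ≤ Zhang2014.kolyvaginIndex W 2 ℓ) :
    Nat.card (galoisCohomology ((W.torsionGaloisModule ((2 ^ M : ℕ) : ℤ)).toLocal (Sum.inr v)) 1) = 4 ^ M := by
  haveI : Fact (Nat.Prime 2) := ⟨Nat.prime_two⟩
  have h := natCard_galoisCohomology_one_torsion_eq_sq_of_not_mem v W hM0 (two_notMem_of_odd_prime_mem hℓ2 hv)
  have hker : Nat.card (nsmulAddMonoidHom (2 ^ M) :
      (W.baseChange (v.adicCompletion ℚ)).toAffine.Point →+ _).ker = 2 ^ M := by
    rw [← zsmulAddGroupHom_natCast]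
    exact natCard_ker_zsmul_adicCompletion_two_pow_eq W hΔ hℓ2 hgoodℓ hℓ hv hM
  rw [hker, ← pow_mul, mul_comm, pow_mul] at h
  exact h

/-! ## §2 The order-4 auxiliary class with every place of `T` free -/

/-- **An order-4 auxiliary class, unconditionally.**  `E/ℚ` with `Δ < 0` and `ρ̄_{E,2}` onto (so `E(ℚ)[2] = 0`); `T` a NON-EMPTY finite set of places,
each the place of a Gross–Kolyvagin prime `ℓ ≠ 2` of good reduction with `Frob_ℓ = Frob_∞` and `kolyvaginIndex ≥ 2`.  Then
**`∃ y ∈ H¹_{𝓛, ⊤ on T}(ℚ, E[4])` with `2•y ≠ 0`** (Kummer at every place outside `T`, no condition on `T`).  Proof: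
`exists_mem_solutions_nsmul_ne_zero_canonical` at levels `(2, 4)` with `M_u = ⊤`; the level map is `H¹(E[2] ↪ E[4])`
(`torsionH1OfDvd_pow_injective`, `…RTLevelRange`); the numbers are `#H¹(ℚ_ℓ,E[2]) = 4`, `#H¹(ℚ_ℓ,E[4]) = 16` (§1), so
`64^{#T} < 256^{#T}`. [cite: McCallumLMS1991, §2 Prop. 2.1 and §5 proof of Prop. 5.2] [cite: MilneADT2006, Ch. I, Thm. 4.10] -/
theorem exists_mem_kummerOutside_four_two_nsmul_ne_zero (hΔ : W.Δ < 0) (hρ2 : W.HasSurjectiveModNGaloisRep 2)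
    {K : Type} [Field K] [NumberField K] (T : Finset (Place ℚ)) (hT : T.Nonempty)
    (hTK : ∀ u ∈ T, ∃ (v : HeightOneSpectrum (𝓞 ℚ)) (ℓ : ℕ) (_ : Fact ℓ.Prime), u = Sum.inr v ∧ ℓ ≠ 2 ∧ (ℓ : 𝓞 ℚ) ∈ v.asIdeal ∧
      W.HasGoodReductionAtPrime ℓ ∧ FrobEqFrobInfty W K 2 ℓ ∧ 2 ≤ Zhang2014.kolyvaginIndex W 2 ℓ) :
    ∃ y ∈ kummerOutside W (2 ^ 2) T, 2 • y ≠ 0 := by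
  classical
  haveI : Fact (Nat.Prime 2) := ⟨Nat.prime_two⟩
  -- local counts on `T`
  have hcount : ∀ (M : ℕ), M ≠ 0 → M ≤ 2 → ∀ u : ↥T,
      Nat.card (galoisCohomology ((W.torsionGaloisModule ((2 ^ M : ℕ) : ℤ)).toLocal (u : Place ℚ)) 1) = 4 ^ M := by
    intro M hM0 hM2 u
    obtain ⟨v, ℓ, hℓp, hu, hℓ2, hv, hgood, hFrob, hidx⟩ := hTK u u.2
    rw [hu]
    exact natCard_galoisCohomology_one_toLocal_two_pow_eq W hΔ hℓ2 hgood hFrob hv hM0 (hM2.trans hidx)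
  -- Weil pairings at levels 2 and 4
  obtain ⟨e₂, hμ₂, hadd₁₂, hadd₂₂, halt₂, hnondeg₂, hgal₂⟩ :=
    W.exists_weilPairing_holds (2 ^ 1) (by norm_num) (by norm_num)
  obtain ⟨e₄, hμ₄, hadd₁₄, hadd₂₄, halt₄, hnondeg₄, hgal₄⟩ :=
    W.exists_weilPairing_holds (2 ^ 2) (by norm_num) (by norm_num)
  -- product localisations
  set loc₂ : galoisCohomology (W.torsionGaloisModule ((2 ^ 1 : ℕ) : ℤ)) 1 →+
      (∀ u : ↥T, galoisCohomology ((W.torsionGaloisModule ((2 ^ 1 : ℕ) : ℤ)).toLocal (u : Place ℚ)) 1) :=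
    AddMonoidHom.pi fun u ↦ galoisCohomology.localization (W.torsionGaloisModule ((2 ^ 1 : ℕ) : ℤ)) (u : Place ℚ) 1 with hloc₂d
  set loc₄ : galoisCohomology (W.torsionGaloisModule ((2 ^ 2 : ℕ) : ℤ)) 1 →+
      (∀ u : ↥T, galoisCohomology ((W.torsionGaloisModule ((2 ^ 2 : ℕ) : ℤ)).toLocal (u : Place ℚ)) 1) :=
    AddMonoidHom.pi fun u ↦ galoisCohomology.localization (W.torsionGaloisModule ((2 ^ 2 : ℕ) : ℤ)) (u : Place ℚ) 1 with hloc₄d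
  have hloc₂ : ∀ c u, loc₂ c u = galoisCohomology.localization (W.torsionGaloisModule ((2 ^ 1 : ℕ) : ℤ)) (u : Place ℚ) 1 c :=
    fun c u ↦ rfl
  have hloc₄ : ∀ c u, loc₄ c u = galoisCohomology.localization (W.torsionGaloisModule ((2 ^ 2 : ℕ) : ℤ)) (u : Place ℚ) 1 c :=
    fun c u ↦ rfl
  -- the level map
  have hdvd : ((2 ^ 1 : ℕ) : ℤ) ∣ ((2 ^ (1 + 1) : ℕ) : ℤ) := by norm_num
  -- `E(ℚ)[2] = 0` (for every decidability instance on `ℚ`: the general-field lemmas use the classical one)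
  have hι : Injective (galoisCohomology.map (W.torsionInclusion hdvd) 1) := by
    intro x y hxy
    rw [map_torsionInclusion_one_apply, map_torsionInclusion_one_apply] at hxy
    exact VisiblePairAtTwo.torsionH1OfDvd_pow_injective W (p := 2) (VisiblePairAtTwo.torsionBy_two_eq_bot_of_surj W hρ2) hdvd hxy
  -- the solution group with `M = ⊤` on `T` is all of `H¹_{𝓛, ⊤ on T}`
  set M : ∀ u : ↥T, AddSubgroup (galoisCohomology ((W.torsionGaloisModule ((2 ^ 2 : ℕ) : ℤ)).toLocal (u : Place ℚ)) 1) :=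
    fun _ ↦ ⊤ with hMdef
  -- the numerical hypothesis: `∏ 4 · ∏ 16 < (∏ 16)²`
  have h2 : ∀ u : ↥T, Nat.card (galoisCohomology ((W.torsionGaloisModule ((2 ^ 1 : ℕ) : ℤ)).toLocal (u : Place ℚ)) 1) = 4 :=
    fun u ↦ by rw [hcount 1 one_ne_zero (by norm_num) u, pow_one]
  have h4 : ∀ u : ↥T, Nat.card (galoisCohomology ((W.torsionGaloisModule ((2 ^ (1 + 1) : ℕ) : ℤ)).toLocal (u : Place ℚ)) 1) =
      16 := fun u ↦ by rw [hcount (1 + 1) (by norm_num) le_rfl u]; norm_num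
  have hM16 : ∀ u : ↥T, Nat.card (M u) = 16 := fun u ↦ by rw [hMdef, AddSubgroup.card_top]; exact h4 u
  have hlt : (∏ u : ↥T, Nat.card (galoisCohomology ((W.torsionGaloisModule ((2 ^ 1 : ℕ) : ℤ)).toLocal (u : Place ℚ)) 1)) *
      (∏ u : ↥T, Nat.card (galoisCohomology ((W.torsionGaloisModule ((2 ^ (1 + 1) : ℕ) : ℤ)).toLocal (u : Place ℚ)) 1)) <
      (∏ u : ↥T, Nat.card (M u)) ^ 2 := by
    rw [Finset.prod_congr rfl fun u _ ↦ h2 u, Finset.prod_congr rfl fun u _ ↦ h4 u, Finset.prod_congr rfl fun u _ ↦ hM16 u,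
      Finset.prod_const, Finset.prod_const, Finset.card_univ, Fintype.card_coe, ← mul_pow, ← pow_mul]
    have hcard : 0 < T.card := Finset.card_pos.mpr hT
    calc (4 * 16) ^ T.card < (16 ^ 2) ^ T.card := Nat.pow_lt_pow_left (by norm_num) hcard.ne'
      _ = 16 ^ (T.card * 2) := by rw [← pow_mul, mul_comm]
  obtain ⟨y, hy, hy2⟩ := exists_mem_solutions_nsmul_ne_zero_canonical W 2 1 (1 + 1) e₂ hμ₂ hadd₁₂ hadd₂₂ hgal₂ halt₂ hnondeg₂
    e₄ hμ₄ hadd₁₄ hadd₂₄ hgal₄ halt₄ hnondeg₄ one_pos (by norm_num) 2 T loc₂ hloc₂ loc₄ hloc₄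
    (galoisCohomology.map (W.torsionInclusion hdvd) 1) hι
    (fun c hc ↦ (map_torsionInclusion_mem_kummerOutside_iff W hdvd T c).mpr hc)
    (fun y hyT hy ↦ exists_map_torsionInclusion_eq_of_mem_kummerOutside W 2
      (VisiblePairAtTwo.torsionBy_two_eq_bot_of_surj W hρ2) 1 1 hdvd T y hyT (by simpa using hy))
    (fun c u hc ↦ by
      rw [hloc₄]
      exact localization_map_torsionInclusion_eq_zero W hdvd (u : Place ℚ) c (by rw [← hloc₂]; exact hc))
    M hlt
  exact ⟨y, hy.1, hy2⟩

/-! ## §3 The same for the TWIN `Wd ≅ E^{(d_K)}` at the Kolyvagin primes of `(E, K)` (appendix, g16) -/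

open Summit.BirchSwinnertonDyer.BirchSwinnertonDyer.Theorems.GenusExact.TwinGrossPrimes in
/-- **The order-4 auxiliary for the twin.**  For a globally minimal model `Wd` of `E^{(d_K)}` (`K` imaginary quadratic, `d_K` odd), the
hypotheses of `exists_mem_kummerOutside_four_two_nsmul_ne_zero` transfer from `E` to `Wd` at the Gross–Kolyvagin primes `ℓ ∤ d_K` of
`(E, K)` (`Δ(Wd) < 0`, `ρ̄_{Wd,2}` onto, good reduction, `Frob_ℓ = Frob_∞` on `Wd[2]`, equal Kolyvagin index — tree
`…TwinGrossPrimes`), so **`∃ y ∈ H¹_{𝓛,⊤ on T}(ℚ, Wd[4])` with `2•y ≠ 0`**: the auxiliary of the bottom-rung engine on the (−)-side.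
[cite: McCallumLMS1991, §2 Prop. 2.1 and §5 proof of Prop. 5.2] [cite: GrossLMS1991, §3 (3.2)–(3.3)] -/
theorem exists_mem_kummerOutside_four_two_nsmul_ne_zero_twin {K : Type} [Field K] [NumberField K]
    (hK : IsImaginaryQuadratic K) (hodd : Odd (NumberField.discr K)) (hΔ : W.Δ < 0) (hρ2 : W.HasSurjectiveModNGaloisRep 2)
    (Wd : WeierstrassCurve ℚ) [Wd.IsElliptic] [Wd.IsGloballyMinimal] {C : VariableChange ℚ}
    (hC : C • W.quadraticTwist ((NumberField.discr K : ℤ) : ℚ) = Wd)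
    (T : Finset (Place ℚ)) (hT : T.Nonempty)
    (hTK : ∀ u ∈ T, ∃ (v : HeightOneSpectrum (𝓞 ℚ)) (ℓ : ℕ) (_ : Fact ℓ.Prime), u = Sum.inr v ∧ ℓ ≠ 2 ∧ (ℓ : 𝓞 ℚ) ∈ v.asIdeal ∧
      ¬ ((ℓ : ℤ) ∣ NumberField.discr K) ∧ W.HasGoodReductionAtPrime ℓ ∧ FrobEqFrobInfty W K 2 ℓ ∧
      2 ≤ Zhang2014.kolyvaginIndex W 2 ℓ) :
    ∃ y ∈ kummerOutside Wd (2 ^ 2) T, 2 • y ≠ 0 := by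
  have hd : ((NumberField.discr K : ℤ) : ℚ) ≠ 0 := by exact_mod_cast NumberField.discr_ne_zero K
  have hΔ' : Wd.Δ < 0 := Δ_neg_of_smul_quadraticTwist_eq W hd Wd hC hΔ
  have hρ2' : Wd.HasSurjectiveModNGaloisRep 2 := by
    rw [← hC]
    exact hasSurjectiveModNGaloisRep_smul _ C 2 ((hasSurjectiveModNGaloisRep_two_quadraticTwist_iff W hd).mpr hρ2)
  refine exists_mem_kummerOutside_four_two_nsmul_ne_zero Wd hΔ' hρ2' (K := K) T hT fun u hu ↦ ?_
  obtain ⟨v, ℓ, hℓp, huv, hℓ2, hv, hℓd, hgood, hFrob, hidx⟩ := hTK u hu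
  refine ⟨v, ℓ, hℓp, huv, hℓ2, hv, hasGoodReductionAtPrime_of_smul_quadraticTwist_eq W hK.1 hodd Wd hC hℓd hgood,
    frobEqFrobInfty_of_smul_quadraticTwist_eq W hK Wd hC hFrob, ?_⟩
  rwa [kolyvaginIndex_eq_of_smul_quadraticTwist_eq W hK.1 hodd Wd hC hℓ2 hℓd hgood 2]

end Summit.BirchSwinnertonDyer.BirchSwinnertonDyer.Theorems.GenusExact.RelaxedCount

end
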